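import Summits.QuantumFields.YangMills.Theorems.FluctuationComparisonRegPrIntLWreg
import Summits.QuantumFields.YangMills.Theorems.UnitScaleTiltFluctuationComparisonRegPrSmallFieldRecursion
import HarnessLib

/-!
# PREG-TOP and the PREG DOOR — the registered row `stub_partialWindowPositivityCan : PartialWindowPositivityCan` (PREG) of 20520's skeleton of record
# `Cruxes/FluctuationComparisonRegPrIntL/Lines/odds_ledger.lean` v1.2 (LINE g20-2 «ODDS LEDGER FOR LFR♯ᶜ»), SPLIT BY DEPTH

Cell `ym3-torus` (HUMAN RULING D-0037: YM₃ on T³ = YM-ladder rung R3 — NOT `d = 4`, NOT infinite volume, NOT a mass gap, NOT Clay).  Width seat `ym3-torus-px21`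
gen 12; helper of the deciding crux `UnitScaleTilt.FluctuationComparisonRegPrIntL` (stmt-QuantumFields-20520), `--supports … --as helper`; def-free, default heartbeats.

THE ROW.  PREG asks: given positivity of the canonical small-history density `heightDensityCan^{histGood K J}` on the `θ_J`-window `W`, EVERY partial
canonical density `q_M := heightDensityCan^{histGoodBelow M}` (`histGoodBelow θ K J M` = «the averaged fields at the depths `j < M` are `θ(K−j)`-small»,
the line's depth filtration of Bałaban's UV-small-history event [Balaban1985UV3] (7) p.257) is positive on `W`.  The line card sizes it «S∕M, WREG's pens
re-run for `histGoodBelow M`».  THIS FILE RECORDS THAT THE ROW SPLITS BY DEPTH: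

* §1 `histGoodBelow θ K J M = histGood F ℰp θ K (K + 1 − M)` (`M ≤ K − J + 1`), `= histGood … K J` (`M > K − J`); `histGood K J = histGood K (J+1) ∩ D_{J,K}⁻¹(W)`.
* §2 generic `Node00.canonVersion` bookkeeping: an a.e. identity ON AN OPEN SET transports `regSet`-membership and the canonical version; an a.e. `≤`
  between functions continuous on an open set of an open-positive measure holds pointwise there.
* §3 `heightDensity` is monotone in the event a.e. (✓`LogComparisonSmallFieldRecursion.towerDensity_mono_ae` through `fieldShift`), and
  `heightDensity^{histGood K J} = heightDensity^{histGood K (J+1)}` a.e. ON THE WINDOW (test-function identity ✓`LogComparisonOneTower.integral_heightDensity_mul`).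
* §4 ★ **PREG-TOP** `partialWindowPositivity_top` — PREG's registered text (the line-local `histGoodBelow` written as its set-builder, `heightDensityCan` :=
  ✓`…WregGlue.heightDensityCan`, δ-equal to the line's) with ONE guard `K − J ≤ M`: PROVED by name from the organ WREG ✓`…Wreg.windowRegularity` ((R) + (P)),
  `γ₁ := γ₁^{WREG}`, `pS := 0` — at these depths the event is `histGood K J` (`M > K − J`) or `histGood K (J+1)` (`M = K − J`), same canonical version on `W`.
* §5 ★★ **THE PREG DOOR** `partialWindowPositivityCan_of_lowRegSet` — PREG's FULL registered text from ONE named regularity input: for the depths `M < K − J`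
  the window lies in `Node00.regSet` of `heightDensity^{histGoodBelow M}`; positivity is then free (`q_M ≥ q^{histGood} > 0` pointwise on the open `W`).

WHY THE LOW DEPTHS ARE NOT «WREG's pens re-run» (honest sizing note for the LEAD ∕ the line owner; nothing below depends on it).  Off `regSet` the
canonical version IS `heightDensity` verbatim (lit `Node00.canonVersion_eq_of_not_mem`), an iterated Radon–Nikodym derivative (`AveragingRT.rnTransport`
= Mathlib `rnDeriv`) whose value at a point is not determined — so ANY proof of `0 < q_M(U)` must first put `W ⊆ regSet (heightDensity^{histGoodBelow M})`,
which is exactly §5's input.  For `M < K − J` the event `histGood K (K+1−M)` read at height `J` leaves the averaged fields at the depths `M, …, K−J−1`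
FREE, so its fine fields are NOT in the charted set `{U | ∀ c, U (iterCentralBond (K−J) c) ∈ chainWindow α (K−J) U c}` of ✓`…WregDescendChart.
exists_chartData_descendTo_reg` (its `hSsub`; ✓`…WregAssembly.histGood_subset_charted` needs smallness at EVERY depth `< K − J`): the regularity of
those densities on the window is the regularity of the contributions of fine fields with α-LARGE intermediate averaged fields — the large-field side
of print ([Balaban1985UV3] (38)–(47) pp.266–267), the same wall as LEV's (i), not a second run of the WREG table.  At `M = 0` (`q_0 = heightDensityCan^{univ}`)
PREG demands, hypothesis-free, a continuous version on the `θ_J`-window of the full `(K−J)`-descended Gibbs density for every `K > J`; under the organ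
LFR♯ᶜ's own `ν = ρ·dU`, `ρ` continuous and positive on `W`, that case is the VERS argument (px19 g11, `canon = Z_K·ρ` on `W`), but PREG's signature carries no `ν∕ρ`.

HONEST SCOPE.  Bookkeeping over landed theorems; NO estimate of Bałaban's is asserted or proved; PREG (all depths), VERS, LEV, LFR♯ᶜ, S2β, the crux
`FluctuationComparisonRegPrIntL` (stmt-QuantumFields-20520), `YM3TorusSU2` and every summit statement are NOT proved here; rung R3 (YM₃ on T³) is NOT d = 4,
NOT infinite volume, NOT a mass gap, NOT Clay; the Yang–Mills mass gap is NOT proved.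

References: [Balaban1985UV3] CMP 102 (1985) (2) p.256, (6)–(7) p.257, (38)–(47) pp.266–267; [Balaban1987RG1] CMP 109 (1987) (0.13) p.254, (2.10) p.267.
-/

set_option autoImplicit false
noncomputable section

open MeasureTheory Filter Topology Set
open scoped ENNReal NNReal
open Literature.MathematicalPhysics.QuantumFieldTheory.Balaban1983to89
open Literature.MathematicalPhysics.QuantumFieldTheory.Balaban1983to89.T3ContinuumYM3Torus
open Literature.MathematicalPhysics.QuantumFieldTheory.Balaban1983to89.T3NestedUnitLaws
open Literature.MathematicalPhysics.QuantumFieldTheory.Balaban1983to89.T3UnitLawDensityEML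
open Literature.MathematicalPhysics.QuantumFieldTheory.Balaban1983to89.T3UnitScaleTilt
open Literature.MathematicalPhysics.QuantumFieldTheory.Balaban1983to89.T3TiltDescent
open Literature.MathematicalPhysics.QuantumFieldTheory.Balaban1983to89.T3RestrictedUnitDensity
open Literature.MathematicalPhysics.QuantumFieldTheory.Balaban1983to89.T3PrintedRegularMinimiser
open Literature.MathematicalPhysics.QuantumFieldTheory.Balaban1983to89.T3LevelShift
open Literature.MathematicalPhysics.QuantumFieldTheory.Balaban1983to89.T3SmallLiftHistory
open Literature.MathematicalPhysics.QuantumFieldTheory.Balaban1983to89.T3Thresholds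
open Literature.MathematicalPhysics.QuantumFieldTheory.Balaban1983to89.Missing
open Literature.MathematicalPhysics.QuantumFieldTheory.Balaban1983to89.T4Continuum
open scoped Literature.MathematicalPhysics.QuantumFieldTheory.Balaban1983to89.T3OrbitAverage

namespace Summit.QuantumFields.YangMills.Theorems.FluctuationComparisonRegPrIntLOddsLedgerPregTop

open Summit.QuantumFields.YangMills.Theorems.FluctuationComparisonRegPrIntLWregGlue (heightDensityCan)
open Summit.QuantumFields.YangMills.Theorems.FluctuationComparisonRegPrIntLWreg (windowRegularity)

/-! ## §1 The depth filtration is Bałaban's event with more free top steps; the top constraint is the window -/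

section Events

variable (F : T3Family) (θ : ℕ → ℝ)

/-- **THE DEPTH-FILTERED EVENT IS BAŁABAN'S EVENT WITH `K + 1 − M` FREE TOP STEPS**: «the averaged fields at the depths `j < M` are small» (the line's
`histGoodBelow θ K J M`, written as its set-builder) `= histGood F ℰp θ K (K + 1 − M)` whenever `M ≤ K − J + 1` (`j < M ⟺ j + (K+1−M) ≤ K`).
[cite: Balaban1985UV3, (7) p.257] -/
theorem setOf_depthBelow_eq_histGood {J K M : ℕ} (hJK : J ≤ K) (hM : M ≤ K - J + 1) :
    {U : GaugeField (F.P K) 0 (Matrix.specialUnitaryGroup (Fin 2) ℂ) |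
        ∀ j, j + J ≤ K → j < M → PlaqSmall (θ (K - j)) (Averaging.iter (fun i => BlockAveraging.blockAvg (P := F.P K) (j := i) ℰp) j U)} =
      histGood F ℰp θ K (K + 1 - M) := by
  ext U
  simp only [histGood, Set.mem_setOf_eq]
  constructor
  · intro h j hj
    exact h j (by omega) (by omega)
  · intro h j _ hjM
    exact h j (by omega)

/-- Above the height-`J` scale the depth filtration IS Bałaban's event with `J` free top steps (`M > K − J`; the line's `histGoodBelow_of_lt`).
[cite: Balaban1985UV3, (7) p.257] -/
theorem setOf_depthBelow_eq_histGood_of_lt {J K M : ℕ} (h : K - J < M) :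
    {U : GaugeField (F.P K) 0 (Matrix.specialUnitaryGroup (Fin 2) ℂ) |
        ∀ j, j + J ≤ K → j < M → PlaqSmall (θ (K - j)) (Averaging.iter (fun i => BlockAveraging.blockAvg (P := F.P K) (j := i) ℰp) j U)} =
      histGood F ℰp θ K J := by
  ext U
  simp only [histGood, Set.mem_setOf_eq]
  constructor
  · intro hU j hj
    exact hU j hj (by omega)
  · intro hU j hj _
    exact hU j hj

/-- The small-plaquette window is invariant under the level identification of two towers (plaquettes correspond, `plaqShift`; local copy of the
`SmallFieldWidening…` letter to keep the imports light). [cite: Balaban1987RG1, (0.18) p.255] -/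
theorem plaqSmall_fieldShift_iff {m K j m' K' j' : ℕ} (h : (F.PP m K).sitesPerDir j = (F.PP m' K').sitesPerDir j') (δ : ℝ)
    (V : GaugeField (F.PP m' K') j' (Matrix.specialUnitaryGroup (Fin 2) ℂ)) : PlaqSmall δ (fieldShift h V) ↔ PlaqSmall δ V := by
  unfold PlaqSmall
  simp_rw [plaqHol_fieldShift h V]
  refine ⟨fun hV p => ?_, fun hV p => hV _⟩
  have hp := hV ((plaqShift h).symm p)
  rwa [Equiv.apply_symm_apply] at hp

/-- **THE TOP CONSTRAINT IS THE WINDOW**: `histGood K J = histGood K (J+1) ∩ D_{J,K}⁻¹{PlaqSmall θ(J)}` — the event with `J` free top steps is the one with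
`J + 1` free top steps cut by the `θ_J`-window read through the descent `D_{J,K}` (cf. ✓`…PrintChiDescentAdapter.histGood_eq_inter_preimage_top`, here
with the `fieldShift` reading of `descendTo`). [cite: Balaban1985UV3, (7) p.257] -/
theorem histGood_eq_succ_inter_preimage_window {J K : ℕ} (hJK : J ≤ K) :
    histGood F ℰp θ K J = histGood F ℰp θ K (J + 1) ∩
      (descendTo F ℰp J K hJK) ⁻¹' {V : GaugeField (F.P J) 0 (Matrix.specialUnitaryGroup (Fin 2) ℂ) | PlaqSmall (θ J) V} := by
  ext U
  simp only [histGood, Set.mem_setOf_eq, Set.mem_inter_iff, Set.mem_preimage]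
  constructor
  · intro hU
    refine ⟨fun j hj => hU j (by omega), ?_⟩
    have hK := hU (K - J) (by omega)
    rw [show K - (K - J) = J by omega] at hK
    unfold descendTo
    exact (plaqSmall_fieldShift_iff F _ (θ J) _).2 hK
  · rintro ⟨hU, htop⟩ j hj
    by_cases hjK : j = K - J
    · subst hjK
      rw [show K - (K - J) = J by omega]
      unfold descendTo at htop
      exact (plaqSmall_fieldShift_iff F _ (θ J) _).1 htop
    · exact hU j (by omega)

end Events

/-! ## §2 Generic bookkeeping for the canonical version: transport along an a.e. identity on an open set; a.e. `≤` ⟹ pointwise `≤` for continuous versions -/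

section Generic

variable {α : Type*} [TopologicalSpace α] [MeasurableSpace α] [SecondCountableTopology α] [OpensMeasurableSpace α]
  {μ : Measure α} [μ.IsOpenPosMeasure]

/-- **LOCAL VERSION-INDEPENDENCE**: if `f₁ = f₂` a.e. ON AN OPEN SET `W` lying in the maximal regular set of `f₁`, then `W` lies in the maximal regular
set of `f₂` and the two canonical versions AGREE AT EVERY POINT of `W` (the continuous version of `f₁` on `W` is one of `f₂`; determinacy on open sets).
[cite: Balaban1987RG1, (0.13) p.254 (bookkeeping)] -/
theorem regSet_canonVersion_of_ae_eq_on_open {f₁ f₂ : α → ℝ} {W : Set α} (hW : IsOpen W) (h : f₁ =ᵐ[μ.restrict W] f₂)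
    (h₁ : W ⊆ Node00.regSet μ f₁) :
    W ⊆ Node00.regSet μ f₂ ∧ EqOn (Node00.canonVersion μ f₁) (Node00.canonVersion μ f₂) W := by
  obtain ⟨g, hg, hae⟩ := (Node00.hasContVersionOn_regSet (μ := μ) (f := f₁)).mono h₁
  have hae₂ : g =ᵐ[μ.restrict W] f₂ := hae.trans h
  refine ⟨Node00.subset_regSet hW ⟨g, hg, hae₂⟩, fun x hx => ?_⟩
  rw [Node00.canonVersion_eqOn_of_continuousOn hW hg hae hx, Node00.canonVersion_eqOn_of_continuousOn hW hg hae₂ hx]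

omit [SecondCountableTopology α] [OpensMeasurableSpace α] in
/-- **A.E. `≤` IS POINTWISE `≤` FOR VERSIONS CONTINUOUS ON AN OPEN SET** (open-positive measure): `g₁ ⊓ g₂` and `g₁` are continuous on `W` and agree
a.e. there, hence everywhere on `W` (Mathlib `Measure.eqOn_open_of_ae_eq`). [folklore] -/
theorem le_on_open_of_ae_le {g₁ g₂ : α → ℝ} {W : Set α} (hW : IsOpen W) (hg₁ : ContinuousOn g₁ W) (hg₂ : ContinuousOn g₂ W)
    (h : g₁ ≤ᵐ[μ.restrict W] g₂) : ∀ x ∈ W, g₁ x ≤ g₂ x := by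
  have hmin : (fun x => g₁ x ⊓ g₂ x) =ᵐ[μ.restrict W] g₁ := h.mono fun x hx => inf_eq_left.2 hx
  have heq := Measure.eqOn_open_of_ae_eq hmin hW (hg₁.inf hg₂) hg₁
  intro x hx
  have hx' : g₁ x ⊓ g₂ x = g₁ x := heq hx
  rw [← hx']
  exact inf_le_right

end Generic

/-! ## §3 `heightDensity`: monotone in the event a.e.; the top window drops out a.e. on the window -/

section Height

variable (F : T3Family)

/-- **THE RESTRICTED HEIGHT DENSITY IS MONOTONE IN THE EVENT, A.E.**: `S ⊆ S′` ⇒ `heightDensity^{S} ≤ heightDensity^{S′}` `dV^{(J)}`-a.e. (the start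
densities `𝟙_S·e^{−β_K A} ≤ 𝟙_{S′}·e^{−β_K A}` pointwise, the Radon–Nikodym tower is monotone a.e. ✓`towerDensity_mono_ae`, and the level identification
`fieldShift` preserves product Haar). [cite: Balaban1985UV3, (2) p.256 and (6) p.257] -/
theorem heightDensity_mono_ae {γ : ℝ} (hγ : 0 ≤ γ) {J K : ℕ} (hJK : J ≤ K)
    {S S' : Set (GaugeField (F.P K) 0 (Matrix.specialUnitaryGroup (Fin 2) ℂ))} (hS : MeasurableSet S) (hS' : MeasurableSet S') (hSS' : S ⊆ S') :
    heightDensity F γ hJK S ≤ᵐ[fieldMeasure (F.P J) 0 (Matrix.specialUnitaryGroup (Fin 2) ℂ)] heightDensity F γ hJK S' := by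
  have h0 : resDensity F γ K S 0 ≤ᵐ[fieldMeasure (F.P K) 0 (Matrix.specialUnitaryGroup (Fin 2) ℂ)] resDensity F γ K S' 0 :=
    Eventually.of_forall fun U => Set.indicator_le_indicator_of_subset hSS' (fun V => (boltzmann_pos (F.P K) _ V).le) U
  have hk : resDensity F γ K S (K - J) ≤ᵐ[fieldMeasure (F.P K) (K - J) (Matrix.specialUnitaryGroup (Fin 2) ℂ)] resDensity F γ K S' (K - J) :=
    Summit.QuantumFields.YangMills.Theorems.LogComparisonSmallFieldRecursion.towerDensity_mono_ae F K
      (integrable_resDensity F K hS hγ (k := 0) (Nat.zero_le _)) (integrable_resDensity F K hS' hγ (k := 0) (Nat.zero_le _)) h0 (K - J)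
      (by omega)
  have hs := F.sitesPerDir_eq (m := F.m) (K := K) (j := K - J) (m' := F.m) (K' := J) (j' := 0) (by omega)
  show ∀ᵐ V ∂fieldMeasure (F.P J) 0 (Matrix.specialUnitaryGroup (Fin 2) ℂ),
    resDensity F γ K S (K - J) (fieldShift hs V) ≤ resDensity F γ K S' (K - J) (fieldShift hs V)
  exact (measurePreserving_fieldShift hs).quasiMeasurePreserving.ae hk

/-- The fine integrands of the two test-function integrals agree: on fine fields descending INTO the window the two events coincide, elsewhere the
test function vanishes. [cite: Balaban1985UV3, (7) p.257] -/
theorem indicator_histGood_mul_eq_succ {γ : ℝ} {J K : ℕ} (hJK : J ≤ K) (θ : ℕ → ℝ)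
    (g : GaugeField (F.P J) 0 (Matrix.specialUnitaryGroup (Fin 2) ℂ) → ℝ)
    (hg : ∀ V, ¬ PlaqSmall (θ J) V → g V = 0) (U : GaugeField (F.P K) 0 (Matrix.specialUnitaryGroup (Fin 2) ℂ)) :
    (histGood F ℰp θ K J).indicator (boltzmann (F.P K) ((F.scheme ℰp γ).β K)) U * g (descendTo F ℰp J K hJK U) =
      (histGood F ℰp θ K (J + 1)).indicator (boltzmann (F.P K) ((F.scheme ℰp γ).β K)) U * g (descendTo F ℰp J K hJK U) := by
  by_cases hW : PlaqSmall (θ J) (descendTo F ℰp J K hJK U)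
  · have hiff : U ∈ histGood F ℰp θ K J ↔ U ∈ histGood F ℰp θ K (J + 1) := by
      rw [histGood_eq_succ_inter_preimage_window F θ hJK]
      exact ⟨fun h => h.1, fun h => ⟨h, hW⟩⟩
    by_cases hU : U ∈ histGood F ℰp θ K (J + 1)
    · rw [Set.indicator_of_mem (hiff.2 hU), Set.indicator_of_mem hU]
    · rw [Set.indicator_of_notMem (fun h => hU (hiff.1 h)), Set.indicator_of_notMem hU]
  · rw [hg _ hW, mul_zero, mul_zero]

/-- **THE TOP WINDOW DROPS OUT ON THE WINDOW**: `heightDensity^{histGood K J} = heightDensity^{histGood K (J+1)}` a.e. ON `{PlaqSmall θ(J)}` — both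
integrate every bounded test function supported in the window to `∫_{histGood K (J+1)} e^{−β_K A(U)}·g(D_{J,K}U) dU`
(✓`LogComparisonOneTower.integral_heightDensity_mul` and §1). [cite: Balaban1985UV3, (2) p.256 and (7) p.257] -/
theorem heightDensity_histGood_ae_eq_succ_on_window {γ : ℝ} (hγ : 0 ≤ γ) {J K : ℕ} (hJK : J ≤ K) (θ : ℕ → ℝ) :
    heightDensity F γ hJK (histGood F ℰp θ K J)
      =ᵐ[(fieldMeasure (F.P J) 0 (Matrix.specialUnitaryGroup (Fin 2) ℂ)).restrict {V | PlaqSmall (θ J) V}]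
      heightDensity F γ hJK (histGood F ℰp θ K (J + 1)) := by
  set μ := fieldMeasure (F.P J) 0 (Matrix.specialUnitaryGroup (Fin 2) ℂ) with hμ
  set W : Set (GaugeField (F.P J) 0 (Matrix.specialUnitaryGroup (Fin 2) ℂ)) := {V | PlaqSmall (θ J) V} with hW_def
  have hWm : MeasurableSet W := (Node00.isOpen_plaqSmall (θ J)).measurableSet
  have hS₁ : MeasurableSet (histGood F ℰp θ K J) := measurableSet_histGood F ℰp measurableE_ℰp θ K J
  have hS₂ : MeasurableSet (histGood F ℰp θ K (J + 1)) := measurableSet_histGood F ℰp measurableE_ℰp θ K (J + 1)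
  set f₁ := heightDensity F γ hJK (histGood F ℰp θ K J) with hf₁
  set f₂ := heightDensity F γ hJK (histGood F ℰp θ K (J + 1)) with hf₂
  have hi₁ : Integrable f₁ μ := (heightDensity_props F hJK hS₁ hγ).2
  have hi₂ : Integrable f₂ μ := (heightDensity_props F hJK hS₂ hγ).2
  -- the window-cut densities agree a.e. for the full measure
  have hind : W.indicator f₁ =ᵐ[μ] W.indicator f₂ := by
    refine Integrable.ae_eq_of_forall_setIntegral_eq _ _ (hi₁.indicator hWm) (hi₂.indicator hWm) fun s hs _ => ?_
    have hsW : MeasurableSet (s ∩ W) := hs.inter hWm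
    set g : GaugeField (F.P J) 0 (Matrix.specialUnitaryGroup (Fin 2) ℂ) → ℝ := (s ∩ W).indicator (fun _ => (1 : ℝ)) with hg_def
    have hgm : Measurable g := measurable_const.indicator hsW
    have hgC : ∃ C : ℝ, ∀ V, |g V| ≤ C := ⟨1, fun V => by
      rw [hg_def]
      by_cases hV : V ∈ s ∩ W
      · simp [Set.indicator_of_mem hV]
      · simp [Set.indicator_of_notMem hV]⟩
    have hg0 : ∀ V, ¬ PlaqSmall (θ J) V → g V = 0 := fun V hV =>
      Set.indicator_of_notMem (fun h => hV h.2) _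
    have key : ∀ (f : GaugeField (F.P J) 0 (Matrix.specialUnitaryGroup (Fin 2) ℂ) → ℝ),
        ∫ V in s, W.indicator f V ∂μ = ∫ V, f V * g V ∂μ := fun f => by
      rw [setIntegral_indicator hWm, ← integral_indicator hsW]
      refine integral_congr_ae (Eventually.of_forall fun V => ?_)
      show (s ∩ W).indicator f V = f V * (s ∩ W).indicator (fun _ => (1 : ℝ)) V
      by_cases hV : V ∈ s ∩ W
      · rw [Set.indicator_of_mem hV, Set.indicator_of_mem hV, mul_one]
      · rw [Set.indicator_of_notMem hV, Set.indicator_of_notMem hV, mul_zero]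
    rw [key f₁, key f₂, hf₁, hf₂,
      Summit.QuantumFields.YangMills.Theorems.LogComparisonOneTower.integral_heightDensity_mul F K hJK hγ hS₁ g hgm hgC,
      Summit.QuantumFields.YangMills.Theorems.LogComparisonOneTower.integral_heightDensity_mul F K hJK hγ hS₂ g hgm hgC]
    exact integral_congr_ae (Eventually.of_forall fun U => indicator_histGood_mul_eq_succ F hJK θ g hg0 U)
  -- read it on the window
  rw [Filter.EventuallyEq, ae_restrict_iff' hWm]
  filter_upwards [hind] with V hV hVW
  simpa only [Set.indicator_of_mem hVW] using hV

end Height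

/-! ## §4 PREG-TOP: the partial canonical densities at the depths `M ≥ K − J` are positive on the window, BY NAME from WREG -/

section Top

variable (F : T3Family)

/-- **AT THE DEPTH `M = K − J` THE PARTIAL CANONICAL DENSITY IS THE SMALL-HISTORY ONE ON THE WINDOW**: if the window lies in `regSet` of
`heightDensity^{histGood K J}` (WREG's (R)), then `heightDensityCan^{histGood K (J+1)} = heightDensityCan^{histGood K J}` AT EVERY POINT of the window
(§3's a.e. identity on the open window + §2's transport), and the window lies in `regSet` of `heightDensity^{histGood K (J+1)}` too.
[cite: Balaban1987RG1, (0.13) p.254; Balaban1985UV3, (7) p.257] -/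
theorem heightDensityCan_succ_eq_on_window {γ : ℝ} (hγ : 0 ≤ γ) {J K : ℕ} (hJK : J ≤ K) (θ : ℕ → ℝ)
    (hreg : {V : GaugeField (F.P J) 0 (Matrix.specialUnitaryGroup (Fin 2) ℂ) | PlaqSmall (θ J) V} ⊆
      Node00.regSet (fieldMeasure (F.P J) 0 (Matrix.specialUnitaryGroup (Fin 2) ℂ)) (heightDensity F γ hJK (histGood F ℰp θ K J))) :
    {V : GaugeField (F.P J) 0 (Matrix.specialUnitaryGroup (Fin 2) ℂ) | PlaqSmall (θ J) V} ⊆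
        Node00.regSet (fieldMeasure (F.P J) 0 (Matrix.specialUnitaryGroup (Fin 2) ℂ)) (heightDensity F γ hJK (histGood F ℰp θ K (J + 1))) ∧
      ∀ V : GaugeField (F.P J) 0 (Matrix.specialUnitaryGroup (Fin 2) ℂ), PlaqSmall (θ J) V →
        heightDensityCan F γ hJK (histGood F ℰp θ K (J + 1)) V = heightDensityCan F γ hJK (histGood F ℰp θ K J) V := by
  haveI := B12ContinuousTransportInvariance.isOpenPosMeasure_fieldMeasure_SU (N := 2) (F.P J) 0
  obtain ⟨hreg', heq⟩ := regSet_canonVersion_of_ae_eq_on_open (Node00.isOpen_plaqSmall (θ J))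
    (heightDensity_histGood_ae_eq_succ_on_window F hγ hJK θ) hreg
  exact ⟨hreg', fun V hV => (heq hV).symm⟩

/-- ★ **PREG-TOP · WINDOW POSITIVITY OF THE PARTIAL CANONICAL DENSITIES AT THE DEPTHS `M ≥ K − J`** — the registered text of
`stub_partialWindowPositivityCan : PartialWindowPositivityCan` (LINE g20-2 `Lines/odds_ledger.lean` v1.2; `histGoodBelow` written out, `heightDensityCan` :=
✓`…WregGlue.heightDensityCan`) with the ONE extra guard `K − J ≤ M`: for `M > K − J` the event is `histGood K J` and the hypothesis applies verbatim; at
`M = K − J` it is `histGood K (J+1)` (§1), whose canonical density agrees with `histGood K J`'s on the window (`heightDensityCan_succ_eq_on_window`, fed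
by WREG's (R) ✓`…Wreg.windowRegularity` at `γ′ := γ`).  Thresholds: `pS := 0`, `γ₁ := γ₁^{WREG}(L, b₀, p₀)`.  The LOW depths `M < K − J` are NOT covered
(see the file header and §5). [cite: Balaban1985UV3, (2) p.256 and (7) p.257; Balaban1987RG1, (2.10) p.267] -/
theorem partialWindowPositivity_top :
    ∀ (L : ℕ), ∃ pS : ℝ, ∀ (b₀ p₀ : ℝ), 0 < b₀ → pS ≤ p₀ → 0 < p₀ →
      ∃ γ₁ : ℝ, 0 < γ₁ ∧ ∀ (F : T3Family) (γ : ℝ), F.L = L → 0 < γ → γ ≤ γ₁ →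
        ∀ (J K : ℕ) (hJK : J ≤ K),
          (∀ U : GaugeField (F.P J) 0 (Matrix.specialUnitaryGroup (Fin 2) ℂ), PlaqSmall (θBal F.L γ b₀ p₀ J) U →
              0 < heightDensityCan F γ hJK (histGood F ℰp (θBal F.L γ b₀ p₀) K J) U) →
          ∀ (M : ℕ) (U : GaugeField (F.P J) 0 (Matrix.specialUnitaryGroup (Fin 2) ℂ)), PlaqSmall (θBal F.L γ b₀ p₀ J) U → K - J ≤ M →
            0 < heightDensityCan F γ hJK
              {U' : GaugeField (F.P K) 0 (Matrix.specialUnitaryGroup (Fin 2) ℂ) | ∀ j, j + J ≤ K → j < M →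
                PlaqSmall (θBal F.L γ b₀ p₀ (K - j)) (Averaging.iter (fun i => BlockAveraging.blockAvg (P := F.P K) (j := i) ℰp) j U')} U := by
  intro L
  refine ⟨0, fun b₀ p₀ hb₀ _ hp₀ => ?_⟩
  obtain ⟨γ₁, hγ₁, hWREG⟩ := windowRegularity L b₀ p₀ hb₀ hp₀
  refine ⟨γ₁, hγ₁, fun F γ hL hγ hγle J K hJK hpos M U hU hM => ?_⟩
  rcases Nat.lt_or_ge (K - J) M with hlt | hge
  · rw [setOf_depthBelow_eq_histGood_of_lt F (θBal F.L γ b₀ p₀) hlt]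
    exact hpos U hU
  · have hMeq : M = K - J := le_antisymm hge hM
    have hev := setOf_depthBelow_eq_histGood F (θBal F.L γ b₀ p₀) (J := J) (K := K) (M := M) hJK (by omega)
    rw [show K + 1 - M = J + 1 by omega] at hev
    rw [hev]
    obtain ⟨hreg, -⟩ := hWREG F γ hL hγ hγle J K hJK γ hγ
    rw [(heightDensityCan_succ_eq_on_window F hγ.le hJK (θBal F.L γ b₀ p₀) hreg).2 U hU]
    exact hpos U hU

end Top

/-! ## §5 THE PREG DOOR: the full row from ONE regularity input at the low depths -/

section Door

variable (F : T3Family)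

/-- **POSITIVITY IS FREE ONCE THE WINDOW IS REGULAR**: for events `S ⊆ S′` with the open window inside `regSet` of BOTH height densities, positivity of
the canonical version of the smaller event's density at a window point gives positivity of the larger's (monotonicity a.e. §3 + continuity of both
canonical versions on the window + product Haar charges open sets, §2). [cite: Balaban1985UV3, (2) p.256 and (6) p.257; Balaban1987RG1, (0.13) p.254] -/
theorem heightDensityCan_pos_of_subset_of_regSet {γ : ℝ} (hγ : 0 ≤ γ) {J K : ℕ} (hJK : J ≤ K)
    {S S' : Set (GaugeField (F.P K) 0 (Matrix.specialUnitaryGroup (Fin 2) ℂ))} (hS : MeasurableSet S) (hS' : MeasurableSet S') (hSS' : S ⊆ S')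
    {W : Set (GaugeField (F.P J) 0 (Matrix.specialUnitaryGroup (Fin 2) ℂ))} (hW : IsOpen W)
    (hreg : W ⊆ Node00.regSet (fieldMeasure (F.P J) 0 (Matrix.specialUnitaryGroup (Fin 2) ℂ)) (heightDensity F γ hJK S))
    (hreg' : W ⊆ Node00.regSet (fieldMeasure (F.P J) 0 (Matrix.specialUnitaryGroup (Fin 2) ℂ)) (heightDensity F γ hJK S'))
    {V : GaugeField (F.P J) 0 (Matrix.specialUnitaryGroup (Fin 2) ℂ)} (hV : V ∈ W) (hpos : 0 < heightDensityCan F γ hJK S V) :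
    0 < heightDensityCan F γ hJK S' V := by
  haveI := B12ContinuousTransportInvariance.isOpenPosMeasure_fieldMeasure_SU (N := 2) (F.P J) 0
  set μ := fieldMeasure (F.P J) 0 (Matrix.specialUnitaryGroup (Fin 2) ℂ) with hμ
  have hc : ContinuousOn (Node00.canonVersion μ (heightDensity F γ hJK S)) W := Node00.continuousOn_canonVersion.mono hreg
  have hc' : ContinuousOn (Node00.canonVersion μ (heightDensity F γ hJK S')) W := Node00.continuousOn_canonVersion.mono hreg'
  have hle : Node00.canonVersion μ (heightDensity F γ hJK S) ≤ᵐ[μ.restrict W] Node00.canonVersion μ (heightDensity F γ hJK S') := by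
    refine ae_restrict_of_ae ?_
    filter_upwards [Node00.canonVersion_ae_eq (μ := μ) (f := heightDensity F γ hJK S),
      Node00.canonVersion_ae_eq (μ := μ) (f := heightDensity F γ hJK S'), heightDensity_mono_ae F hγ hJK hS hS' hSS'] with x h1 h2 h3
    rw [h1, h2]
    exact h3
  exact lt_of_lt_of_le hpos (le_on_open_of_ae_le hW hc hc' hle V hV)

/-- ★★ **THE PREG DOOR — `PartialWindowPositivityCan` FROM ONE NAMED REGULARITY ROW AT THE LOW DEPTHS**: if, below WREG-type thresholds, for every run
`K`, height `J ≤ K` and depth `M < K − J` the `θ_J`-window lies in the maximal regular set (`Node00.regSet`) of the height-`J` density of the run-`K`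
Gibbs weight restricted to «the averaged fields at the depths `j < M` are small» (the line's `histGoodBelow M`), THEN PREG's registered text holds
(conclusion verbatim, `heightDensityCan` := ✓`…WregGlue.heightDensityCan`): the low depths by `heightDensityCan_pos_of_subset_of_regSet` (`histGood K J ⊆
histGoodBelow M`, WREG's (R) and positivity ✓`…Wreg.windowRegularity`), the top depths as in §4.  The input `hlow` is NOT proved anywhere in the tree: for
`M < K − J` the event leaves the depths `M … K−J−1` free and lies outside the charted set of ✓`exists_chartData_descendTo_reg`; it is the window-regularity
of the large-intermediate-field contributions ([Balaban1985UV3] (38)–(47)), recorded here as the row PREG actually needs. [cite: Balaban1985UV3, (7) p.257 and (38)-(47) p.266-267; Balaban1987RG1, (0.13) p.254 and (2.10) p.267] -/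
theorem partialWindowPositivityCan_of_lowRegSet
    (hlow : ∀ (L : ℕ), ∃ pS : ℝ, ∀ (b₀ p₀ : ℝ), 0 < b₀ → pS ≤ p₀ → 0 < p₀ →
      ∃ γ₁ : ℝ, 0 < γ₁ ∧ ∀ (F : T3Family) (γ : ℝ), F.L = L → 0 < γ → γ ≤ γ₁ →
        ∀ (J K : ℕ) (hJK : J ≤ K) (M : ℕ), M < K - J →
          {V : GaugeField (F.P J) 0 (Matrix.specialUnitaryGroup (Fin 2) ℂ) | PlaqSmall (θBal F.L γ b₀ p₀ J) V} ⊆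
            Node00.regSet (fieldMeasure (F.P J) 0 (Matrix.specialUnitaryGroup (Fin 2) ℂ))
              (heightDensity F γ hJK
                {U' : GaugeField (F.P K) 0 (Matrix.specialUnitaryGroup (Fin 2) ℂ) | ∀ j, j + J ≤ K → j < M →
                  PlaqSmall (θBal F.L γ b₀ p₀ (K - j)) (Averaging.iter (fun i => BlockAveraging.blockAvg (P := F.P K) (j := i) ℰp) j U')})) :
    ∀ (L : ℕ), ∃ pS : ℝ, ∀ (b₀ p₀ : ℝ), 0 < b₀ → pS ≤ p₀ → 0 < p₀ →
      ∃ γ₁ : ℝ, 0 < γ₁ ∧ ∀ (F : T3Family) (γ : ℝ), F.L = L → 0 < γ → γ ≤ γ₁ →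
        ∀ (J K : ℕ) (hJK : J ≤ K),
          (∀ U : GaugeField (F.P J) 0 (Matrix.specialUnitaryGroup (Fin 2) ℂ), PlaqSmall (θBal F.L γ b₀ p₀ J) U →
              0 < heightDensityCan F γ hJK (histGood F ℰp (θBal F.L γ b₀ p₀) K J) U) →
          ∀ (M : ℕ) (U : GaugeField (F.P J) 0 (Matrix.specialUnitaryGroup (Fin 2) ℂ)), PlaqSmall (θBal F.L γ b₀ p₀ J) U →
            0 < heightDensityCan F γ hJK
              {U' : GaugeField (F.P K) 0 (Matrix.specialUnitaryGroup (Fin 2) ℂ) | ∀ j, j + J ≤ K → j < M →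
                PlaqSmall (θBal F.L γ b₀ p₀ (K - j)) (Averaging.iter (fun i => BlockAveraging.blockAvg (P := F.P K) (j := i) ℰp) j U')} U := by
  intro L
  obtain ⟨pS, hlowL⟩ := hlow L
  obtain ⟨pT, htopL⟩ := partialWindowPositivity_top L
  refine ⟨max pS pT, fun b₀ p₀ hb₀ hpS hp₀ => ?_⟩
  obtain ⟨γL, hγL, hlowF⟩ := hlowL b₀ p₀ hb₀ ((le_max_left _ _).trans hpS) hp₀
  obtain ⟨γT, hγT, htopF⟩ := htopL b₀ p₀ hb₀ ((le_max_right _ _).trans hpS) hp₀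
  obtain ⟨γW, hγW, hWREG⟩ := windowRegularity L b₀ p₀ hb₀ hp₀
  refine ⟨min (min γL γT) γW, lt_min (lt_min hγL hγT) hγW, fun F γ hL hγ hγle J K hJK hpos M U hU => ?_⟩
  have hγL' : γ ≤ γL := hγle.trans ((min_le_left _ _).trans (min_le_left _ _))
  have hγT' : γ ≤ γT := hγle.trans ((min_le_left _ _).trans (min_le_right _ _))
  have hγW' : γ ≤ γW := hγle.trans (min_le_right _ _)
  by_cases hM : K - J ≤ M
  · exact htopF F γ hL hγ hγT' J K hJK hpos M U hU hM
  · have hMlt : M < K - J := Nat.lt_of_not_le hM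
    obtain ⟨hregW, hposW⟩ := hWREG F γ hL hγ hγW' J K hJK γ hγ
    have hSsub : histGood F ℰp (θBal F.L γ b₀ p₀) K J ⊆
        {U' : GaugeField (F.P K) 0 (Matrix.specialUnitaryGroup (Fin 2) ℂ) | ∀ j, j + J ≤ K → j < M →
          PlaqSmall (θBal F.L γ b₀ p₀ (K - j)) (Averaging.iter (fun i => BlockAveraging.blockAvg (P := F.P K) (j := i) ℰp) j U')} :=
      fun U' hU' j hj _ => hU' j hj
    have hSm' : MeasurableSet
        {U' : GaugeField (F.P K) 0 (Matrix.specialUnitaryGroup (Fin 2) ℂ) | ∀ j, j + J ≤ K → j < M →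
          PlaqSmall (θBal F.L γ b₀ p₀ (K - j)) (Averaging.iter (fun i => BlockAveraging.blockAvg (P := F.P K) (j := i) ℰp) j U')} := by
      rw [setOf_depthBelow_eq_histGood F (θBal F.L γ b₀ p₀) hJK (by omega)]
      exact measurableSet_histGood F ℰp measurableE_ℰp _ K _
    exact heightDensityCan_pos_of_subset_of_regSet F hγ.le hJK (measurableSet_histGood F ℰp measurableE_ℰp _ K J) hSm' hSsub
      (Node00.isOpen_plaqSmall _) hregW (hlowF F γ hL hγ hγL' J K hJK M hMlt) hU (hposW U hU)

end Door

end Summit.QuantumFields.YangMills.Theorems.FluctuationComparisonRegPrIntLOddsLedgerPregTop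

end
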